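import Summits.QuantumFields.YangMills.Theorems.BalabanLadderUVNonSUNRecHaarChart
import HarnessLib

/-!
# Lemma A on a closed subgroup `G ≤ U(N)` (2∕2): the local coordinate expression, the chartwise null pieces, and the MAIN THEOREM
# `haar_restrict_map_absolutelyContinuous` — any Haar measure

Support module for the residual `UVNonSUNRec` of `Summit.QuantumFields.YangMills.Theses.BalabanLadder` (item stmt-QuantumFields-19356
`UVOtherGroups`; `--supports stmt-QuantumFields-19356`) — kernel property #2 of the `(G, r)`-averaging prescription (`HaarAC`), Part I(b);
continues `…UVNonSUNRecHaarChart` (§1–§2).  Written by planner ym-novel-YangMills-othergroups g5 (candidate 3cbf0470a57448b3 §3), landed by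
prover ym-osasm-p2 g6 (split at the 400-line rule; text otherwise verbatim).

* §3 the local coordinate expression `X' ↦ logG(Vⱼ⁻¹ K(V expG X'))` has an INVERTIBLE strict derivative on the relevant open set (tangent
  injectivity on `W·𝐠` and `det jac(X) ≠ 0`), the chartwise pieces of the bad set are Lebesgue-null
  (`T4RadialProjectionAC.measure_inter_preimage_null_of_hasStrictFDerivAt`);
* **MAIN THEOREM** `haar_restrict_map_absolutelyContinuous`: `S ⊆ G` open, `K : G → G` measurable, `K♯ : M_N(ℂ) → M_N(ℂ)` with, for
  every `W ∈ S`, a strict real Fréchet derivative `D W` at `↑W`, `K♯ ↑W = ↑(K W)`, and TANGENT INJECTIVITY ON `W·𝐠` ⇒ for every Haar measure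
  `μ` on `G`, `(μ.restrict S).map K ≪ μ`; corollary `…_of_skew` under the `U(N)` file's stronger all-skew hypothesis (`𝐠 ⊆ 𝔲(N)`).

HONEST SCOPE as in Part I(a): pure measure theory on compact matrix groups; nothing printed by Bałaban is asserted; not a gap, not Clay.
-/

noncomputable section

open NormedSpace Metric Set Filter Topology MeasureTheory
open scoped ENNReal NNReal

namespace Summit.QuantumFields.YangMills.Theorems.UVNonSUNRecHaarClosedSubgroup

open Literature.MathematicalPhysics.QuantumFieldTheory.Balaban1983to89
open HaarExpChartClosedSubgroup (chart hlie expG coe_expG continuous_expG measurable_expG exists_haar_apply_eq_expChart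
  ext_iff_coe compactSpace)
open HaarExpChartLocal (jdet jdet_def measurable_jdet proj proj_apply_coe coe_proj_of_mem dexp_coe_eq)
open B13HaarSigmaJacobian (jac)
open MatrixLog (mlog exp_mlog analyticAt_mlog)
open LogChartClosedSubgroup (star_eq_neg_of_mem_unitarySubgroupLogChart_lie)
open Literature.Analysis.Calculus.ExpDifferential (dexp hasFDerivAt_exp_dexp hasStrictFDerivAt_exp_dexp)
open T4RadialProjectionAC (measure_inter_preimage_null_of_hasStrictFDerivAt)
open scoped Matrix Matrix.Norms.L2Operator

variable {n : Type*} [Fintype n] [DecidableEq n]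
variable (Gs : Subgroup (Matrix.unitaryGroup n ℂ)) (hG : IsClosed (Gs : Set (Matrix.unitaryGroup n ℂ)))

/-! ## §3 Local coordinates, the chartwise pieces, and the main theorem -/

section Main

variable [MeasurableSpace (chart Gs hG).lie] [BorelSpace (chart Gs hG).lie]

omit [MeasurableSpace (chart Gs hG).lie] [BorelSpace (chart Gs hG).lie] in
/-- THE LOCAL COORDINATE EXPRESSION HAS AN INVERTIBLE DERIVATIVE.  Data: `S` open, `K`, `K♯`, `D` as in the main theorem;
`V, Vⱼ ∈ G`; an open set `O` of parameters inside the window ball on which `V · expG X' ∈ S` and `Vⱼ⁻¹ · K (V · expG X')`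
lies in the window `N_e`.  Then at every `X ∈ O` the map `f : X' ↦ logG (Vⱼ⁻¹ · K (V · expG X'))` has an INVERTIBLE strict
derivative.  (Near `X`, `f` is the smooth `proj ∘ log ∘ (Vⱼ⁻¹·) ∘ K♯ ∘ (V·) ∘ exp`; its derivative `L` satisfies
`paramD Vⱼ (f X) ∘ L = D W ∘ paramD V X`, `W = V · expG X`, by differentiating `Vⱼ e^{f(·)} = K♯(V e^{·})` on `O`; so `L v = 0`
gives `D W (↑W · jac(X) v) = 0`, whence `jac(X) v = 0` by tangent injectivity on `W·𝐠` and `v = 0` as `det jac(X) > 0`.) [folklore] -/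
theorem exists_equiv_hasStrictFDerivAt_localCoord {r : ℝ} (hr2 : r ≤ Real.log 2)
    (hjpos : ∀ X : (chart Gs hG).lie, ‖X‖ < r → 0 < jdet (hlie Gs hG) X)
    {S : Set Gs} {K : Gs → Gs} {Kmat : Matrix n n ℂ → Matrix n n ℂ} {D : Gs → Matrix n n ℂ →L[ℝ] Matrix n n ℂ}
    (hd : ∀ W ∈ S, HasStrictFDerivAt Kmat (D W) (((W : Gs) : Matrix.unitaryGroup n ℂ) : Matrix n n ℂ))
    (hKmat : ∀ W ∈ S, Kmat (((W : Gs) : Matrix.unitaryGroup n ℂ) : Matrix n n ℂ) =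
      (((K W : Gs) : Matrix.unitaryGroup n ℂ) : Matrix n n ℂ))
    (hinj : ∀ W ∈ S, ∀ Y : (chart Gs hG).lie,
      D W ((((W : Gs) : Matrix.unitaryGroup n ℂ) : Matrix n n ℂ) * (Y : Matrix n n ℂ)) = 0 → Y = 0)
    (V Vj : Gs) {O : Set (chart Gs hG).lie} (hO : IsOpen O) (hOr : ∀ X' ∈ O, ‖X'‖ < r)
    (hOS : ∀ X' ∈ O, V * expG Gs hG X' ∈ S)
    (hOj : ∀ X' ∈ O, Vj⁻¹ * K (V * expG Gs hG X') ∈ expG Gs hG '' ball (0 : (chart Gs hG).lie) r)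
    {X : (chart Gs hG).lie} (hX : X ∈ O) :
    ∃ E : (chart Gs hG).lie ≃L[ℝ] (chart Gs hG).lie,
      HasStrictFDerivAt (fun X' => logG Gs hG (Vj⁻¹ * K (V * expG Gs hG X')))
        (E : (chart Gs hG).lie →L[ℝ] (chart Gs hG).lie) X := by
  set W : Gs := V * expG Gs hG X with hW
  have hWS : W ∈ S := hOS X hX
  -- `K♯ ∘ (X' ↦ V e^{X'})` is strictly differentiable at `X`
  have hVX : (((V : Gs) : Matrix.unitaryGroup n ℂ) : Matrix n n ℂ) * exp (X : Matrix n n ℂ) =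
      (((W : Gs) : Matrix.unitaryGroup n ℂ) : Matrix n n ℂ) := (coe_mul_expG Gs hG V X).symm
  have hKd : HasStrictFDerivAt Kmat (D W) ((((V : Gs) : Matrix.unitaryGroup n ℂ) : Matrix n n ℂ) * exp (X : Matrix n n ℂ)) := by
    rw [hVX]; exact hd W hWS
  have hKΦ : HasStrictFDerivAt
      (fun X' : (chart Gs hG).lie => Kmat ((((V : Gs) : Matrix.unitaryGroup n ℂ) : Matrix n n ℂ) * exp (X' : Matrix n n ℂ)))
      ((D W).comp (paramD Gs hG V X)) X :=
    hKd.comp X (hasStrictFDerivAt_param Gs hG V X)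
  -- the image point `Vⱼ⁻¹ K W` is a chart point `expG c₀`, `‖c₀‖ < r`
  obtain ⟨c₀, hc₀, hc₀e⟩ := hOj X hX
  have hpt : ((((Vj⁻¹ : Gs) : Gs) : Matrix.unitaryGroup n ℂ) : Matrix n n ℂ) *
      Kmat ((((V : Gs) : Matrix.unitaryGroup n ℂ) : Matrix n n ℂ) * exp (X : Matrix n n ℂ)) = exp (c₀ : Matrix n n ℂ) := by
    rw [hVX, hKmat W hWS, ← coe_expG Gs hG c₀, hc₀e]; rfl
  have hc₀1 : ‖exp (c₀ : Matrix n n ℂ) - 1‖ < 1 :=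
    norm_exp_sub_one_lt_one (show ‖(c₀ : Matrix n n ℂ)‖ < Real.log 2 from (mem_ball_zero_iff.1 hc₀).trans_le hr2)
  have hMl : HasStrictFDerivAt mlog ((fderiv ℂ mlog (exp (c₀ : Matrix n n ℂ))).restrictScalars ℝ)
      (((((Vj⁻¹ : Gs) : Gs) : Matrix.unitaryGroup n ℂ) : Matrix n n ℂ) *
        Kmat ((((V : Gs) : Matrix.unitaryGroup n ℂ) : Matrix n n ℂ) * exp (X : Matrix n n ℂ))) := by
    rw [hpt]; exact (analyticAt_mlog hc₀1).hasStrictFDerivAt.restrictScalars ℝ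
  have hmulj : HasStrictFDerivAt (fun M : Matrix n n ℂ => ((((Vj⁻¹ : Gs) : Gs) : Matrix.unitaryGroup n ℂ) : Matrix n n ℂ) * M)
      (ContinuousLinearMap.mul ℝ (Matrix n n ℂ) ((((Vj⁻¹ : Gs) : Gs) : Matrix.unitaryGroup n ℂ) : Matrix n n ℂ))
      (Kmat ((((V : Gs) : Matrix.unitaryGroup n ℂ) : Matrix n n ℂ) * exp (X : Matrix n n ℂ))) :=
    (ContinuousLinearMap.mul ℝ (Matrix n n ℂ) _).hasStrictFDerivAt
  -- the smooth expression `g` and its derivative `L`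
  set L : (chart Gs hG).lie →L[ℝ] (chart Gs hG).lie :=
    (proj (chart Gs hG)).comp ((((fderiv ℂ mlog (exp (c₀ : Matrix n n ℂ))).restrictScalars ℝ).comp
      ((ContinuousLinearMap.mul ℝ (Matrix n n ℂ) ((((Vj⁻¹ : Gs) : Gs) : Matrix.unitaryGroup n ℂ) : Matrix n n ℂ)).comp
        ((D W).comp (paramD Gs hG V X))))) with hL
  have hg : HasStrictFDerivAt
      (fun X' : (chart Gs hG).lie => proj (chart Gs hG) (mlog (((((Vj⁻¹ : Gs) : Gs) : Matrix.unitaryGroup n ℂ) : Matrix n n ℂ) *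
        Kmat ((((V : Gs) : Matrix.unitaryGroup n ℂ) : Matrix n n ℂ) * exp (X' : Matrix n n ℂ))))) L X :=
    (proj (chart Gs hG)).hasStrictFDerivAt.comp X (hMl.comp X (hmulj.comp X hKΦ))
  -- on `O` every image point is a chart point
  have hchart : ∀ X' ∈ O, ∃ c ∈ ball (0 : (chart Gs hG).lie) r, expG Gs hG c = Vj⁻¹ * K (V * expG Gs hG X') :=
    fun X' hX' => hOj X' hX'
  -- `f = g` near `X`
  have hfg : (fun X' : (chart Gs hG).lie => proj (chart Gs hG) (mlog (((((Vj⁻¹ : Gs) : Gs) : Matrix.unitaryGroup n ℂ) : Matrix n n ℂ) *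
        Kmat ((((V : Gs) : Matrix.unitaryGroup n ℂ) : Matrix n n ℂ) * exp (X' : Matrix n n ℂ))))) =ᶠ[𝓝 X]
      fun X' => logG Gs hG (Vj⁻¹ * K (V * expG Gs hG X')) := by
    filter_upwards [hO.mem_nhds hX] with X' hX'
    obtain ⟨c, hc, hce⟩ := hchart X' hX'
    have hcr : ‖c‖ < Real.log 2 := (mem_ball_zero_iff.1 hc).trans_le hr2
    have hcr' : ‖(c : Matrix n n ℂ)‖ < Real.log 2 := hcr
    rw [← hce, logG_expG Gs hG hcr, ← coe_mul_expG Gs hG V X', hKmat _ (hOS X' hX'),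
      show ((((Vj⁻¹ : Gs) : Gs) : Matrix.unitaryGroup n ℂ) : Matrix n n ℂ) *
          (((K (V * expG Gs hG X') : Gs) : Matrix.unitaryGroup n ℂ) : Matrix n n ℂ) =
        (((Vj⁻¹ * K (V * expG Gs hG X') : Gs) : Matrix.unitaryGroup n ℂ) : Matrix n n ℂ) from rfl,
      ← hce, coe_expG, B7BlockAvgLog.mlog_exp hcr', proj_apply_coe]
  have hf : HasStrictFDerivAt (fun X' => logG Gs hG (Vj⁻¹ * K (V * expG Gs hG X'))) L X :=
    hg.congr_of_eventuallyEq hfg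
  -- the germ identity `Vⱼ e^{f(X')} = K♯ (V e^{X'})` on `O`
  have hgerm : (fun X' : (chart Gs hG).lie => (((Vj : Gs) : Matrix.unitaryGroup n ℂ) : Matrix n n ℂ) *
        exp ((logG Gs hG (Vj⁻¹ * K (V * expG Gs hG X')) : (chart Gs hG).lie) : Matrix n n ℂ)) =ᶠ[𝓝 X]
      fun X' => Kmat ((((V : Gs) : Matrix.unitaryGroup n ℂ) : Matrix n n ℂ) * exp (X' : Matrix n n ℂ)) := by
    filter_upwards [hO.mem_nhds hX] with X' hX'
    obtain ⟨c, hc, hce⟩ := hchart X' hX'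
    have hcr : ‖c‖ < Real.log 2 := (mem_ball_zero_iff.1 hc).trans_le hr2
    rw [← hce, logG_expG Gs hG hcr, ← coe_mul_expG Gs hG Vj c, hce, mul_inv_cancel_left, ← coe_mul_expG Gs hG V X',
      hKmat _ (hOS X' hX')]
  have hR : HasStrictFDerivAt (fun X' : (chart Gs hG).lie => (((Vj : Gs) : Matrix.unitaryGroup n ℂ) : Matrix n n ℂ) *
        exp ((logG Gs hG (Vj⁻¹ * K (V * expG Gs hG X')) : (chart Gs hG).lie) : Matrix n n ℂ))
      ((paramD Gs hG Vj (logG Gs hG (Vj⁻¹ * K (V * expG Gs hG X)))).comp L) X :=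
    (hasStrictFDerivAt_param Gs hG Vj _).comp X hf
  have heq : (paramD Gs hG Vj (logG Gs hG (Vj⁻¹ * K (V * expG Gs hG X)))).comp L = (D W).comp (paramD Gs hG V X) :=
    (hR.hasFDerivAt.congr_of_eventuallyEq hgerm.symm).unique hKΦ.hasFDerivAt
  -- injectivity of `L`
  have hLinj : Function.Injective L := by
    refine (injective_iff_map_eq_zero L).2 fun v hv => ?_
    have h1 : paramD Gs hG Vj (logG Gs hG (Vj⁻¹ * K (V * expG Gs hG X))) (L v) = D W (paramD Gs hG V X v) :=
      DFunLike.congr_fun heq v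
    rw [hv, map_zero, paramD_apply_eq_mul_jac] at h1
    have hY : jac (𝕂 := ℝ) (hlie Gs hG) X v = 0 := hinj W hWS _ h1.symm
    exact jac_eq_zero_imp Gs hG (hjpos X (hOr X hX)).ne' hY
  refine ⟨(LinearEquiv.ofInjectiveEndo L.toLinearMap hLinj).toContinuousLinearEquiv, hf.congr_fderiv ?_⟩
  ext v
  rfl

omit [BorelSpace (chart Gs hG).lie] in
/-- THE PIECE OF THE BAD SET SEEN IN ONE PAIR OF WINDOWS IS NULL.  For `T` measurable with `vol({‖X‖<r} ∩ expG⁻¹(Vⱼ⁻¹T)) = 0`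
and `V, Vⱼ ∈ G`: the set of `X` in the window ball with `V · expG X ∈ S`, `K (V · expG X) ∈ T` and `Vⱼ⁻¹ · K (V · expG X) ∈ N_e`
is `vol`-null (LEMMA A of `T4RadialProjectionAC` for the local coordinate expression on the open set `O`). [folklore] -/
theorem vol_piece_null [BorelSpace (chart Gs hG).lie] (vol : Measure (chart Gs hG).lie) [vol.IsAddHaarMeasure] {r : ℝ}
    (hr2 : r ≤ Real.log 2) (hNo : IsOpen (expG Gs hG '' ball (0 : (chart Gs hG).lie) r))
    (hjpos : ∀ X : (chart Gs hG).lie, ‖X‖ < r → 0 < jdet (hlie Gs hG) X)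
    {S : Set Gs} (hS : IsOpen S) {K : Gs → Gs} (hK : Measurable K) {Kmat : Matrix n n ℂ → Matrix n n ℂ}
    {D : Gs → Matrix n n ℂ →L[ℝ] Matrix n n ℂ}
    (hd : ∀ W ∈ S, HasStrictFDerivAt Kmat (D W) (((W : Gs) : Matrix.unitaryGroup n ℂ) : Matrix n n ℂ))
    (hKmat : ∀ W ∈ S, Kmat (((W : Gs) : Matrix.unitaryGroup n ℂ) : Matrix n n ℂ) =
      (((K W : Gs) : Matrix.unitaryGroup n ℂ) : Matrix n n ℂ))
    (hinj : ∀ W ∈ S, ∀ Y : (chart Gs hG).lie,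
      D W ((((W : Gs) : Matrix.unitaryGroup n ℂ) : Matrix n n ℂ) * (Y : Matrix n n ℂ)) = 0 → Y = 0)
    {T : Set Gs} (hT : MeasurableSet T) (V Vj : Gs)
    (hNj0 : vol (ball (0 : (chart Gs hG).lie) r ∩ expG Gs hG ⁻¹' ((fun U => Vj * U) ⁻¹' T)) = 0) :
    vol (ball (0 : (chart Gs hG).lie) r ∩ expG Gs hG ⁻¹' ((fun U => V * U) ⁻¹' (K ⁻¹' T ∩ S)) ∩
      (fun X => Vj⁻¹ * K (V * expG Gs hG X)) ⁻¹' (expG Gs hG '' ball (0 : (chart Gs hG).lie) r)) = 0 := by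
  -- an ambient open set `Q ⊆ M_N(ℂ)` cutting out the translate `Vⱼ · N_e`
  have hind : IsInducing (fun g : Gs => (((g : Gs) : Matrix.unitaryGroup n ℂ) : Matrix n n ℂ)) :=
    IsInducing.subtypeVal.comp IsInducing.subtypeVal
  obtain ⟨Q, hQo, hQ⟩ : ∃ Q : Set (Matrix n n ℂ), IsOpen Q ∧
      (fun g : Gs => (((g : Gs) : Matrix.unitaryGroup n ℂ) : Matrix n n ℂ)) ⁻¹' Q =
        (fun U => Vj⁻¹ * U) ⁻¹' (expG Gs hG '' ball (0 : (chart Gs hG).lie) r) :=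
    hind.isOpen_iff.1 (hNo.preimage (continuous_const_mul Vj⁻¹))
  -- the open set `O`
  set O : Set (chart Gs hG).lie := (ball (0 : (chart Gs hG).lie) r ∩ {X | V * expG Gs hG X ∈ S}) ∩
    (fun X : (chart Gs hG).lie => Kmat ((((V : Gs) : Matrix.unitaryGroup n ℂ) : Matrix n n ℂ) * exp (X : Matrix n n ℂ))) ⁻¹' Q
    with hO_def
  have hPo : IsOpen (ball (0 : (chart Gs hG).lie) r ∩ {X : (chart Gs hG).lie | V * expG Gs hG X ∈ S}) :=
    isOpen_ball.inter (hS.preimage ((continuous_const_mul V).comp (continuous_expG Gs hG)))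
  have hcont : ContinuousOn
      (fun X : (chart Gs hG).lie => Kmat ((((V : Gs) : Matrix.unitaryGroup n ℂ) : Matrix n n ℂ) * exp (X : Matrix n n ℂ)))
      (ball (0 : (chart Gs hG).lie) r ∩ {X : (chart Gs hG).lie | V * expG Gs hG X ∈ S}) := by
    intro X hX
    have h1 : ContinuousAt Kmat ((((V : Gs) : Matrix.unitaryGroup n ℂ) : Matrix n n ℂ) * exp (X : Matrix n n ℂ)) := by
      rw [← coe_mul_expG]; exact (hd _ hX.2).continuousAt
    exact (h1.comp_of_eq (continuous_param Gs hG V).continuousAt rfl).continuousWithinAt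
  have hO : IsOpen O := hcont.isOpen_inter_preimage hPo hQo
  have hOS : ∀ X' ∈ O, V * expG Gs hG X' ∈ S := fun X' hX' => hX'.1.2
  have hOr : ∀ X' ∈ O, ‖X'‖ < r := fun X' hX' => mem_ball_zero_iff.1 hX'.1.1
  have hmemQ : ∀ X' : (chart Gs hG).lie, V * expG Gs hG X' ∈ S →
      (Kmat ((((V : Gs) : Matrix.unitaryGroup n ℂ) : Matrix n n ℂ) * exp (X' : Matrix n n ℂ)) ∈ Q ↔
        Vj⁻¹ * K (V * expG Gs hG X') ∈ expG Gs hG '' ball (0 : (chart Gs hG).lie) r) := by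
    intro X' hX'
    have h' : K (V * expG Gs hG X') ∈ (fun g : Gs => (((g : Gs) : Matrix.unitaryGroup n ℂ) : Matrix n n ℂ)) ⁻¹' Q ↔
        K (V * expG Gs hG X') ∈ (fun U => Vj⁻¹ * U) ⁻¹' (expG Gs hG '' ball (0 : (chart Gs hG).lie) r) := by
      rw [hQ]
    rw [← coe_mul_expG, hKmat _ hX']
    exact h'
  have hOj : ∀ X' ∈ O, Vj⁻¹ * K (V * expG Gs hG X') ∈ expG Gs hG '' ball (0 : (chart Gs hG).lie) r :=
    fun X' hX' => (hmemQ X' hX'.1.2).1 hX'.2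
  -- the local coordinate expression and the null target
  set f : (chart Gs hG).lie → (chart Gs hG).lie := fun X => logG Gs hG (Vj⁻¹ * K (V * expG Gs hG X)) with hf_def
  have hfm : Measurable f :=
    (measurable_logG Gs hG).comp ((measurable_const_mul _).comp (hK.comp
      ((measurable_const_mul V).comp (measurable_expG Gs hG))))
  have hNjm : MeasurableSet (ball (0 : (chart Gs hG).lie) r ∩ expG Gs hG ⁻¹' ((fun U => Vj * U) ⁻¹' T)) :=
    measurableSet_ball.inter (measurable_expG Gs hG (measurable_const_mul Vj hT))
  -- the piece lies in `O ∩ f⁻¹ Nⱼ`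
  have hsub : ball (0 : (chart Gs hG).lie) r ∩ expG Gs hG ⁻¹' ((fun U => V * U) ⁻¹' (K ⁻¹' T ∩ S)) ∩
      (fun X => Vj⁻¹ * K (V * expG Gs hG X)) ⁻¹' (expG Gs hG '' ball (0 : (chart Gs hG).lie) r) ⊆
      O ∩ f ⁻¹' (ball (0 : (chart Gs hG).lie) r ∩ expG Gs hG ⁻¹' ((fun U => Vj * U) ⁻¹' T)) := by
    rintro X ⟨⟨hXr, hXT, hXS⟩, hXj⟩
    rw [mem_preimage] at hXj
    refine ⟨⟨⟨hXr, hXS⟩, (hmemQ X hXS).2 hXj⟩, ?_⟩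
    obtain ⟨c, hc, hce⟩ := hXj
    have hfX : f X = c := by
      rw [hf_def]; dsimp only; rw [← hce, logG_expG Gs hG ((mem_ball_zero_iff.1 hc).trans_le hr2)]
    rw [mem_preimage, hfX]
    refine ⟨hc, ?_⟩
    show Vj * expG Gs hG c ∈ T
    rw [hce, mul_inv_cancel_left]; exact hXT
  refine measure_mono_null hsub ?_
  have key : ∀ X ∈ O, ∃ E : (chart Gs hG).lie ≃L[ℝ] (chart Gs hG).lie,
      HasStrictFDerivAt f (E : (chart Gs hG).lie →L[ℝ] (chart Gs hG).lie) X := fun X hX =>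
    exists_equiv_hasStrictFDerivAt_localCoord Gs hG hr2 hjpos hd hKmat hinj V Vj hO hOr hOS hOj hX
  choose! E hE using key
  exact measure_inter_preimage_null_of_hasStrictFDerivAt vol hO hNjm hfm (f' := E) hE hNj0

end Main

/-- **MAIN THEOREM: LEMMA A ON A CLOSED SUBGROUP `G ≤ U(N)` FOR AN AMBIENT MATRIX MAP, ANY HAAR MEASURE.**  Let `S ⊆ G` be open,
`K : G → G` measurable, and `K♯ : M_N(ℂ) → M_N(ℂ)` an ambient map with, for every `W ∈ S`: a strict real Fréchet derivative `D W`
at `↑W`, `K♯ ↑W = ↑(K W)`, and TANGENT INJECTIVITY ON `W·𝐠` — `D W` kills no non-zero tangent vector `↑W · Y`, `Y ∈ 𝐠`.  Then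
for every Haar measure `μ` on `G`: `((μ).restrict S).map K ≪ μ`.  (Helgason's canonical coordinates `HaarExpChartClosedSubgroup`:
the null criterion §1, the chartwise pieces §3.) [folklore] -/
theorem haar_restrict_map_absolutelyContinuous (μ : Measure Gs) [μ.IsHaarMeasure] {S : Set Gs} (hS : IsOpen S)
    {K : Gs → Gs} (hK : Measurable K) {Kmat : Matrix n n ℂ → Matrix n n ℂ} {D : Gs → Matrix n n ℂ →L[ℝ] Matrix n n ℂ}
    (hd : ∀ W ∈ S, HasStrictFDerivAt Kmat (D W) (((W : Gs) : Matrix.unitaryGroup n ℂ) : Matrix n n ℂ))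
    (hKmat : ∀ W ∈ S, Kmat (((W : Gs) : Matrix.unitaryGroup n ℂ) : Matrix n n ℂ) =
      (((K W : Gs) : Matrix.unitaryGroup n ℂ) : Matrix n n ℂ))
    (hinj : ∀ W ∈ S, ∀ Y : (chart Gs hG).lie,
      D W ((((W : Gs) : Matrix.unitaryGroup n ℂ) : Matrix n n ℂ) * (Y : Matrix n n ℂ)) = 0 → Y = 0) :
    (μ.restrict S).map K ≪ μ := by
  letI : MeasurableSpace (chart Gs hG).lie := borel _
  haveI : BorelSpace (chart Gs hG).lie := ⟨rfl⟩
  obtain ⟨r, hr, hr2, hNo, -, hjpos, σ₀, hσ0, -, hμ⟩ :=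
    exists_haar_apply_eq_expChart Gs hG μ (Module.finBasis ℝ (chart Gs hG).lie).addHaar
  refine Measure.AbsolutelyContinuous.mk fun T hT hT0 => ?_
  rw [Measure.map_apply hK hT, Measure.restrict_apply (hK hT)]
  refine haar_null_of_forall_vol_null Gs hG μ _ hr hNo hμ ((hK hT).inter hS.measurableSet) fun V => ?_
  obtain ⟨t, ht⟩ := exists_finite_cover Gs hG hr hNo
  have hAsub : ball (0 : (chart Gs hG).lie) r ∩ expG Gs hG ⁻¹' ((fun U => V * U) ⁻¹' (K ⁻¹' T ∩ S)) ⊆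
      ⋃ Vj ∈ t, ball (0 : (chart Gs hG).lie) r ∩ expG Gs hG ⁻¹' ((fun U => V * U) ⁻¹' (K ⁻¹' T ∩ S)) ∩
        (fun X => Vj⁻¹ * K (V * expG Gs hG X)) ⁻¹' (expG Gs hG '' ball (0 : (chart Gs hG).lie) r) := by
    intro X hX
    have hX' := ht (mem_univ (K (V * expG Gs hG X)))
    simp only [mem_iUnion] at hX' ⊢
    obtain ⟨Vj, hVj, hXj⟩ := hX'
    exact ⟨Vj, hVj, hX, hXj⟩
  exact measure_mono_null hAsub ((measure_biUnion_null_iff t.countable_toSet).2 fun Vj _ =>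
    vol_piece_null Gs hG _ hr2 hNo hjpos hS hK hd hKmat hinj hT V Vj
      (vol_null_of_haar_null Gs hG μ _ hNo hjpos hσ0 hμ hT hT0 Vj))

include hG in
/-- **COROLLARY (all skew tangent vectors).**  The same with the `U(N)`-file's stronger tangent hypothesis
`∀ X, Xᴴ = −X → D W (↑W X) = 0 → X = 0` (it implies injectivity on `W·𝐠` since `𝐠 ⊆ 𝔲(N)`). [folklore] -/
theorem haar_restrict_map_absolutelyContinuous_of_skew (μ : Measure Gs) [μ.IsHaarMeasure] {S : Set Gs} (hS : IsOpen S)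
    {K : Gs → Gs} (hK : Measurable K) {Kmat : Matrix n n ℂ → Matrix n n ℂ} {D : Gs → Matrix n n ℂ →L[ℝ] Matrix n n ℂ}
    (hd : ∀ W ∈ S, HasStrictFDerivAt Kmat (D W) (((W : Gs) : Matrix.unitaryGroup n ℂ) : Matrix n n ℂ))
    (hKmat : ∀ W ∈ S, Kmat (((W : Gs) : Matrix.unitaryGroup n ℂ) : Matrix n n ℂ) =
      (((K W : Gs) : Matrix.unitaryGroup n ℂ) : Matrix n n ℂ))
    (hinj : ∀ W ∈ S, ∀ X : Matrix n n ℂ, Xᴴ = -X →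
      D W ((((W : Gs) : Matrix.unitaryGroup n ℂ) : Matrix n n ℂ) * X) = 0 → X = 0) :
    (μ.restrict S).map K ≪ μ :=
  haar_restrict_map_absolutelyContinuous Gs hG μ hS hK hd hKmat fun W hW Y hY =>
    Subtype.ext (hinj W hW (Y : Matrix n n ℂ) (conjTranspose_coe_lie Y) hY)

end Summit.QuantumFields.YangMills.Theorems.UVNonSUNRecHaarClosedSubgroup

end
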